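import Summits.BirchSwinnertonDyer.BirchSwinnertonDyer.Theorems.KimAtThreeShallowEqDeepMultOfDefinedKato
import Summits.BirchSwinnertonDyer.Rank1Residual.GaloisImage.CyclotomicGroupRingEvaluationPadic
import HarnessLib

/-!
# Route `KimAtThreeKolyvagin` (W2): the two-exponent rider from a WEIGHTED exp*-compatibility — the shape
# Kato's DEFINED value datum satisfies at EVERY cyclotomic level (tame AND wild), with no digit lost

Cell `bsd-addord`, seat `bsd-addord-w2-c4` (gen 11; OWNER of crux 19599, item 19077).  `--supports` 19077
(helper).  HONEST FRAMING: TOOL THEOREMS WITH DISPLAYED HYPOTHESES (no definition, no named fact, no instance,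
no `sorry`); `Λ`, `φ` and the weights `θ_r` are ABSTRACT binders; nothing asserted about any curve; nothing
booked; 19560 / 19599 / 19077 / 20396 stay OPEN; BSD is not proved by any of this.  Credit: w2-c3 gen 7's
`KimAtThreeDeepUpperRiderOfCompat` (rider + coordinate functional), w2-acc4's `KimAtThreePortSharedSATCore`.

WHY.  Support item 20396 `DefinedKatoUnitNonAdditiveThree` (= (C1ₑₓ¹ᵘ), this seat gen 10) displays X1-int
with `b = 1` — `3·(φ(h) ⊗ 1 − Λ_{0,r}(y)) ∈ 3^{j+1}·L_int` — at EVERY level `r`, wild levels `r ∋ v₃`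
(`m = 3m′`) included.  For Kato's system with the DEFINED value datum (the deep family's hKatoV2ᵘ, which pins
`Λ_{0,r}` to the defined `exp*_w` at every level and place) `b = 1` is the truth at TAME levels
(`𝒪_w^∨ = 𝒪_w`, `log_ω Ê(3𝒪_w) = 3𝒪_w`), but at a wild level the places `w ∣ 3` are tamely RAMIFIED
(`e = 2`, `𝒪_w^∨ = (1 − ζ₃)⁻¹𝒪_w`) and for an ORDINARY non-additive curve `log_ω Ê(𝔪_w)` has index `3` in
`π𝒪_w` (`log(1 + πu) ≡ π(u − u³) mod π²`): the exp*-lattice is `(1 − ζ₃)⁻¹·3⁻¹·𝒪_w` and `b = 1` FAILS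
(`b = 2` holds) — while the shallow port needs `b = 1` EXACTLY and its consumers quantify over ALL `r`.
REPAIR, consumer-neutral: the **WEIGHTED compatibility** COMPATW_b
`∃ l ∈ L_int, (1 ⊗ θ_r)·3^b·(φ(h) ⊗ 1 − Λ_{0,r}(y)) = 3^{j+1}·l` with WEIGHTS `θ_r ∈ ℤ[ζ_m]`,
`(1 ⊗ θ_r)²·l₀ = 3 ⊗ 1` for some `l₀ ∈ L_int` (`θ_r = 1` tame, `θ_r = 1 − ζ₃` wild), and the **PARITY
rider** COMPATW_b ⟹ RIDER₂ with the SAME exponents as X1-int_b: a `3`-adic number whose square is divisible by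
`3^{2k+1}` is divisible by `3^{k+1}` (`v₃(ℚ₃ˣ) = ℤ` absorbs the half digit `1 − ζ₃`).
* §1 `toZModPow_eq_of_weighted_sub_eq_smul_cycIntLattice` (any `p`, `m`) — `(1 ⊗ θ)·(e ⊗ 1 − v) ∈ p^{k+1}L_int`
  `∧ v − s ⊗ 1 ∈ p^{k+1}L_int ⇒ e ≡ s (mod p^{k+1})` for a weight `θ`; `weight_one` (`θ = 1`);
  `weight_one_sub_zeta_pow` (`p = 3`, `3 ∣ m`: `θ = 1 − ζ_m^{m/3}`, `(1 − ζ₃)²·(−ζ₃²) = 3`).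
* §2 **`rider₂_of_weightedCompat`** — `RIDER₂⟦W, j, t, e, v₃, 3^a·Λ, Λfin_j⟧` from the interface of a
  normalised `φ′` and COMPATW_b at depth `j`, `b ≤ a`, `e = t + a + λ₀`; `compatW_of_compat` (X1-int_b ⟹
  COMPATW_b with `θ_r := 1`).  Consumers: sibling `KimAtThreeShallowEqDeepOffStratumOfDefinedKatoWeighted`.
References: [Kim2022StructureSelmer] §3.3–§3.4.1, Thm. 3.13; [KimNakamura2020] Thm. 2.1 / Cor. 2.4;
[BlochKato1990] §3 (Prop. 3.8, Ex. 3.11); [Kato2004Asterisque] §9.4, Thm. 9.7; J. Neukirch, *Algebraic Number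
Theory* III (2.4)–(2.9) (different of a tamely ramified extension); memo HOME/w2c4/W2C4-WEIGHTED-COMPAT-g11.md.
-/

set_option autoImplicit false
-- the Theorems namespace of a single-conjunct summit repeats the summit name by design (D-0017)
set_option linter.dupNamespace false

noncomputable section

open scoped NumberField TensorProduct ContRepresentation Classical
open CategoryTheory Field Function Finset IsDedekindDomain NumberField WeierstrassCurve
open Rat.HeightOneSpectrum
open Literature.NumberTheory.GaloisRepresentations Literature.NumberTheory.GaloisCohomology
open Literature.NumberTheory.GaloisRepresentations.DiscreteGaloisModule
open Literature.NumberTheory.EllipticCurves Literature.NumberTheory.EllipticCurves.ModularForms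
open Literature.NumberTheory.EllipticCurves.Rank1Residual
open Literature.NumberTheory.EllipticCurves.Kato2004
open Literature.NumberTheory.EllipticCurves.Kato2004.EulerSystemValues
open Summit.BirchSwinnertonDyer.Rank1Residual.GaloisImage
open Summit.BirchSwinnertonDyer.Rank1Residual.Additive.LocalLog
open Summit.BirchSwinnertonDyer.BirchSwinnertonDyer.Theorems
open Summit.BirchSwinnertonDyer.BirchSwinnertonDyer.Theorems.KimAtThreeKolyvaginDefs
open Summit.BirchSwinnertonDyer.BirchSwinnertonDyer.Theorems.KimAtThreeDeepUpperLocalLatticeUniform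
open Summit.BirchSwinnertonDyer.BirchSwinnertonDyer.Theorems.KimAtThreeDeepUpperRiderOfCompat
open Summit.BirchSwinnertonDyer.BirchSwinnertonDyer.Theorems.KimAtThreeShallowEqDeepMultTwoExpFineKato
open Summit.BirchSwinnertonDyer.BirchSwinnertonDyer.Theorems.KimAtThreeShallowEqDeepMultOfDefinedKato

namespace Summit.BirchSwinnertonDyer.BirchSwinnertonDyer.Theorems.KimAtThreeShallowEqDeepRiderOfWeightedCompat

/-- Local notation: the TWO-EXPONENT rider clause (ii₂) at depth `j`, torsion slot `t`, defect exponent `e`,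
place `v`, for the pair `(Λ, Λf)` (seat acc6's RIDER₂, VERBATIM). -/
local notation3 (prettyPrint := false) "RIDER₂⟦" W' ", " j ", " t' ", " e' ", " v' ", " Λ' ", " Λf "⟧" =>
  ∀ (r : Finset (HeightOneSpectrum (𝓞 ℚ)))
    (Ψ : H1 (tateRep W' 3) (cycSubgroup 3 0 r) →+
      continuousCohomology 1
        (subgroupRep (WeierstrassCurve.torsionGaloisModule W' (((3 : ℕ) : ℤ) ^ j * ((3 : ℕ) : ℤ))).toTopRep
          (cycSubgroup 3 0 r))),
    (∀ (φ : contOneCocycles (subgroupRep (tateRep W' 3).toTopRep (cycSubgroup 3 0 r)))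
        (ψ : contOneCocycles
          (subgroupRep (WeierstrassCurve.torsionGaloisModule W' (((3 : ℕ) : ℤ) ^ j * ((3 : ℕ) : ℤ))).toTopRep
            (cycSubgroup 3 0 r))),
        (∀ g, ((ψ.1 g : geomTorsion W' (((3 : ℕ) : ℤ) ^ j * ((3 : ℕ) : ℤ))) : geomPoints W') =
          TateModule.proj 3 (j + 1) (φ.1 g)) →
        Ψ (oneCocycleClass _ φ) = oneCocycleClass _ ψ) →
    ∀ (y : H1 (tateRep W' 3) (cycSubgroup 3 0 r))
      (κ₀ : galoisCohomology (WeierstrassCurve.torsionGaloisModule W' (((3 : ℕ) : ℤ) ^ j * ((3 : ℕ) : ℤ))) 1)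
      (s : ℤ_[3]),
      resSubgroup (WeierstrassCurve.torsionGaloisModule W' (((3 : ℕ) : ℤ) ^ j * ((3 : ℕ) : ℤ))).toTopRep
          (cycSubgroup 3 0 r) 1 κ₀ = Ψ y →
      galoisCohomology.localization (WeierstrassCurve.torsionGaloisModule W' (((3 : ℕ) : ℤ) ^ j * ((3 : ℕ) : ℤ)))
          (Sum.inr v') 1 κ₀ ∈ propagatedSelmerStructure W' 3 j (Sum.inr v') →
      (∃ l ∈ cycIntLattice 3 (cycLevel 3 0 r),
          (((3 : ℕ) : ℤ_[3]) ^ t') • Λ' 0 r y - ((s : ℚ_[3]) ⊗ₜ[ℚ] (1 : CyclotomicField (cycLevel 3 0 r) ℚ)) =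
            (((3 : ℕ) : ℤ_[3]) ^ (j + 1)) • (l : ℚ_[3] ⊗[ℚ] CyclotomicField (cycLevel 3 0 r) ℚ)) →
      ((3 ^ e' : ℕ) : ZMod (3 ^ (j + 1))) *
        Λf (galoisCohomology.localization
          (WeierstrassCurve.torsionGaloisModule W' (((3 : ℕ) : ℤ) ^ j * ((3 : ℕ) : ℤ))) (Sum.inr v') 1 κ₀) =
        PadicInt.toZModPow (j + 1) s

/-- Local notation: the crude compatibility X1-int at depth `j` WITH EXPONENT `b` between Kato's value datum
`Λ_{0,r}` and the scalar dual exponential `φ` at `v` (seat w2-c3's X1-int_b text, VERBATIM). -/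
local notation3 (prettyPrint := false) "COMPAT⟦" W' ", " j ", " v' ", " Λ' ", " φ0 ", " b "⟧" =>
  ∀ (r : Finset (HeightOneSpectrum (𝓞 ℚ)))
    (Ψ : H1 (tateRep W' 3) (cycSubgroup 3 0 r) →+
      continuousCohomology 1 (subgroupRep
        (WeierstrassCurve.torsionGaloisModule W' (((3 : ℕ) : ℤ) ^ j * ((3 : ℕ) : ℤ))).toTopRep (cycSubgroup 3 0 r))),
    (∀ (φ₁ : contOneCocycles (subgroupRep (tateRep W' 3).toTopRep (cycSubgroup 3 0 r)))
        (ψ : contOneCocycles (subgroupRep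
          (WeierstrassCurve.torsionGaloisModule W' (((3 : ℕ) : ℤ) ^ j * ((3 : ℕ) : ℤ))).toTopRep (cycSubgroup 3 0 r))),
        (∀ g, ((ψ.1 g : geomTorsion W' (((3 : ℕ) : ℤ) ^ j * ((3 : ℕ) : ℤ))) : geomPoints W') =
          TateModule.proj 3 (j + 1) (φ₁.1 g)) →
        Ψ (oneCocycleClass _ φ₁) = oneCocycleClass _ ψ) →
    ∀ (y : H1 (tateRep W' 3) (cycSubgroup 3 0 r))
      (κ₀ : galoisCohomology (WeierstrassCurve.torsionGaloisModule W' (((3 : ℕ) : ℤ) ^ j * ((3 : ℕ) : ℤ))) 1)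
      (h : (tateLocalRep W' 3 (Sum.inr v')).cohomology 1),
      resSubgroup (WeierstrassCurve.torsionGaloisModule W' (((3 : ℕ) : ℤ) ^ j * ((3 : ℕ) : ℤ))).toTopRep
          (cycSubgroup 3 0 r) 1 κ₀ = Ψ y →
      galoisCohomology.localization (WeierstrassCurve.torsionGaloisModule W' (((3 : ℕ) : ℤ) ^ j * ((3 : ℕ) : ℤ)))
          (Sum.inr v') 1 κ₀ = tateLocalMap W' 3 j (Sum.inr v') h →
      ∃ l ∈ cycIntLattice 3 (cycLevel 3 0 r),
        (((3 : ℕ) : ℤ_[3]) ^ b) • ((φ0 h ⊗ₜ[ℚ] (1 : CyclotomicField (cycLevel 3 0 r) ℚ)) - Λ' 0 r y) =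
          (((3 : ℕ) : ℤ_[3]) ^ (j + 1)) • (l : ℚ_[3] ⊗[ℚ] CyclotomicField (cycLevel 3 0 r) ℚ)

/-- Local notation: **the WEIGHTED compatibility** at depth `j` with exponent `b` and weights `θ_r ∈ ℚ(ζ_m)`:
`∃ l ∈ L_int, (1 ⊗ θ_r)·3^b·(φ(h) ⊗ 1 − Λ_{0,r}(y)) = 3^{j+1}·l` (X1-int_b is the case `θ_r = 1`). -/
local notation3 (prettyPrint := false) "COMPATW⟦" W' ", " j ", " v' ", " Λ' ", " φ0 ", " b ", " θ' "⟧" =>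
  ∀ (r : Finset (HeightOneSpectrum (𝓞 ℚ)))
    (Ψ : H1 (tateRep W' 3) (cycSubgroup 3 0 r) →+
      continuousCohomology 1 (subgroupRep
        (WeierstrassCurve.torsionGaloisModule W' (((3 : ℕ) : ℤ) ^ j * ((3 : ℕ) : ℤ))).toTopRep (cycSubgroup 3 0 r))),
    (∀ (φ₁ : contOneCocycles (subgroupRep (tateRep W' 3).toTopRep (cycSubgroup 3 0 r)))
        (ψ : contOneCocycles (subgroupRep
          (WeierstrassCurve.torsionGaloisModule W' (((3 : ℕ) : ℤ) ^ j * ((3 : ℕ) : ℤ))).toTopRep (cycSubgroup 3 0 r))),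
        (∀ g, ((ψ.1 g : geomTorsion W' (((3 : ℕ) : ℤ) ^ j * ((3 : ℕ) : ℤ))) : geomPoints W') =
          TateModule.proj 3 (j + 1) (φ₁.1 g)) →
        Ψ (oneCocycleClass _ φ₁) = oneCocycleClass _ ψ) →
    ∀ (y : H1 (tateRep W' 3) (cycSubgroup 3 0 r))
      (κ₀ : galoisCohomology (WeierstrassCurve.torsionGaloisModule W' (((3 : ℕ) : ℤ) ^ j * ((3 : ℕ) : ℤ))) 1)
      (h : (tateLocalRep W' 3 (Sum.inr v')).cohomology 1),
      resSubgroup (WeierstrassCurve.torsionGaloisModule W' (((3 : ℕ) : ℤ) ^ j * ((3 : ℕ) : ℤ))).toTopRep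
          (cycSubgroup 3 0 r) 1 κ₀ = Ψ y →
      galoisCohomology.localization (WeierstrassCurve.torsionGaloisModule W' (((3 : ℕ) : ℤ) ^ j * ((3 : ℕ) : ℤ)))
          (Sum.inr v') 1 κ₀ = tateLocalMap W' 3 j (Sum.inr v') h →
      ∃ l ∈ cycIntLattice 3 (cycLevel 3 0 r),
        ((1 : ℚ_[3]) ⊗ₜ[ℚ] (θ' r : CyclotomicField (cycLevel 3 0 r) ℚ)) *
            ((((3 : ℕ) : ℤ_[3]) ^ b) • ((φ0 h ⊗ₜ[ℚ] (1 : CyclotomicField (cycLevel 3 0 r) ℚ)) - Λ' 0 r y)) =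
          (((3 : ℕ) : ℤ_[3]) ^ (j + 1)) • (l : ℚ_[3] ⊗[ℚ] CyclotomicField (cycLevel 3 0 r) ℚ)

/-- Local notation: **admissible weights** — at every level `r`, `1 ⊗ θ_r ∈ L_int` and `(1 ⊗ θ_r)²·l₀ = 3 ⊗ 1`
for some `l₀ ∈ L_int` (so `θ_r² ∣ 3` in `ℤ₃ ⊗ ℤ[ζ_m]`: `θ_r = 1`, or `θ_r = 1 − ζ₃` when `3 ∣ m`). -/
local notation3 (prettyPrint := false) "WEIGHT⟦" θ' "⟧" =>
  ∀ r : Finset (HeightOneSpectrum (𝓞 ℚ)),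
    ((1 : ℚ_[3]) ⊗ₜ[ℚ] (θ' r : CyclotomicField (cycLevel 3 0 r) ℚ)) ∈ cycIntLattice 3 (cycLevel 3 0 r) ∧
    ∃ l₀ ∈ cycIntLattice 3 (cycLevel 3 0 r),
      ((1 : ℚ_[3]) ⊗ₜ[ℚ] (θ' r : CyclotomicField (cycLevel 3 0 r) ℚ)) *
          ((1 : ℚ_[3]) ⊗ₜ[ℚ] (θ' r : CyclotomicField (cycLevel 3 0 r) ℚ)) * l₀ =
        ((3 : ℕ) : ℚ_[3]) ⊗ₜ[ℚ] (1 : CyclotomicField (cycLevel 3 0 r) ℚ)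

/-! ### §1 The weighted scalar extraction in `ℚ_p ⊗_ℚ ℚ(ζ_m)` (any `p`, any `m`) -/

section Weighted

variable (p : ℕ) [Fact p.Prime] (m : ℕ) [NeZero m]

set_option backward.isDefEq.respectTransparency false in
/-- **Weighted scalar extraction.**  Let `θ ∈ ℚ(ζ_m)` be a WEIGHT: `1 ⊗ θ ∈ L_int(m)` and
`(1 ⊗ θ)²·l₀ = p ⊗ 1` for some `l₀ ∈ L_int(m)`.  If `(1 ⊗ θ)·(e ⊗ 1 − v) ∈ p^{k+1}·L_int` and
`v − s ⊗ 1 ∈ p^{k+1}·L_int` for `e, s ∈ ℤ_p`, then `e ≡ s (mod p^{k+1})`.  Proof: with `x := e − s`,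
`(1 ⊗ θ)·(x ⊗ 1) ∈ p^{k+1}L_int` (`L_int` is a ring); squaring and multiplying by `l₀` gives
`(p·x²) ⊗ 1 ∈ p^{2k+2}L_int`, whence (coordinate functional of the `ζ_m`-power basis, w2-c3's
`exists_coordFunctional`) `‖p·x²‖ ≤ p^{−(2k+2)}`, i.e. `1 + 2·v_p(x) ≥ 2k + 2`; since `v_p(x)` is an INTEGER,
`v_p(x) ≥ k + 1`.  This is where the half digit `(1 − ζ₃)` of a tamely ramified completion is absorbed.
[cite: Kim2022StructureSelmer, §3.4.1 and the proof of Thm. 3.13 (arXiv v3 pp. 26–27)] -/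
theorem toZModPow_eq_of_weighted_sub_eq_smul_cycIntLattice {θ : CyclotomicField m ℚ}
    (hθ : ((1 : ℚ_[p]) ⊗ₜ[ℚ] θ) ∈ cycIntLattice p m)
    (hθ₂ : ∃ l₀ ∈ cycIntLattice p m,
      ((1 : ℚ_[p]) ⊗ₜ[ℚ] θ) * ((1 : ℚ_[p]) ⊗ₜ[ℚ] θ) * l₀ = ((p : ℚ_[p]) ⊗ₜ[ℚ] (1 : CyclotomicField m ℚ)))
    {e s : ℤ_[p]} {v : ℚ_[p] ⊗[ℚ] CyclotomicField m ℚ} {k : ℕ}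
    (he : ∃ μ ∈ cycIntLattice p m, ((1 : ℚ_[p]) ⊗ₜ[ℚ] θ) *
      (((e : ℚ_[p]) ⊗ₜ[ℚ] (1 : CyclotomicField m ℚ)) - v) = ((p : ℤ_[p]) ^ (k + 1)) • μ)
    (hs : ∃ l ∈ cycIntLattice p m, v - ((s : ℚ_[p]) ⊗ₜ[ℚ] (1 : CyclotomicField m ℚ)) =
      ((p : ℤ_[p]) ^ (k + 1)) • l) :
    PadicInt.toZModPow (k + 1) e = PadicInt.toZModPow (k + 1) s := by
  set Θ : ℚ_[p] ⊗[ℚ] CyclotomicField m ℚ := (1 : ℚ_[p]) ⊗ₜ[ℚ] θ with hΘ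
  set P : ℤ_[p] := (p : ℤ_[p]) ^ (k + 1) with hP
  obtain ⟨l₀, hl₀, hθθ⟩ := hθ₂
  obtain ⟨μ, hμ, he⟩ := he
  obtain ⟨l, hl, hs⟩ := hs
  -- `ℤ_p`-multiples as products with `c ⊗ 1`
  have hsmul : ∀ (c : ℤ_[p]) (w : ℚ_[p] ⊗[ℚ] CyclotomicField m ℚ), c • w = ((c : ℚ_[p]) ⊗ₜ[ℚ] (1 : CyclotomicField m ℚ)) * w := by
    intro c w
    rw [KimAtThreePortSharedSATCore.padicInt_smul_eq_coe_smul,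
      KimAtThreePortSharedSATCore.coe_tmul_one_eq_algebraMap, Algebra.smul_def]
  -- `x := e − s` has `Θ · (x ⊗ 1) = P • ν`, `ν ∈ L_int`
  set x : ℤ_[p] := e - s with hx
  set ν : ℚ_[p] ⊗[ℚ] CyclotomicField m ℚ := μ + Θ * l with hν
  have hνmem : ν ∈ cycIntLattice p m :=
    (cycIntLattice p m).add_mem hμ (KimAtThreePortSharedSATCore.mul_mem_cycIntLattice p m hθ hl)
  have hx1 : ((x : ℚ_[p]) ⊗ₜ[ℚ] (1 : CyclotomicField m ℚ)) =
      (((e : ℚ_[p]) ⊗ₜ[ℚ] (1 : CyclotomicField m ℚ)) - v) + (v - ((s : ℚ_[p]) ⊗ₜ[ℚ] (1 : CyclotomicField m ℚ))) := by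
    rw [hx, PadicInt.coe_sub, TensorProduct.sub_tmul]; abel
  have hΘx : Θ * ((x : ℚ_[p]) ⊗ₜ[ℚ] (1 : CyclotomicField m ℚ)) = ((P : ℚ_[p]) ⊗ₜ[ℚ] (1 : CyclotomicField m ℚ)) * ν := by
    rw [hx1, mul_add, he, hs, hν, mul_add, hsmul, hsmul]; ring
  -- square and multiply by `l₀`: `(p·x²) ⊗ 1 = (P²) • (ν·ν·l₀)`
  have hsq : (((p : ℚ_[p]) * ((x : ℚ_[p]) * (x : ℚ_[p]))) ⊗ₜ[ℚ] (1 : CyclotomicField m ℚ)) =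
      (((P * P : ℤ_[p]) : ℚ_[p]) ⊗ₜ[ℚ] (1 : CyclotomicField m ℚ)) * (ν * ν * l₀) := by
    have h1 : (((p : ℚ_[p]) * ((x : ℚ_[p]) * (x : ℚ_[p]))) ⊗ₜ[ℚ] (1 : CyclotomicField m ℚ)) =
        ((x : ℚ_[p]) ⊗ₜ[ℚ] (1 : CyclotomicField m ℚ)) * ((x : ℚ_[p]) ⊗ₜ[ℚ] (1 : CyclotomicField m ℚ)) * (Θ * Θ * l₀) := by
      rw [hθθ, Algebra.TensorProduct.tmul_mul_tmul, Algebra.TensorProduct.tmul_mul_tmul, mul_one, mul_one]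
      congr 1; ring
    have h2 : ((x : ℚ_[p]) ⊗ₜ[ℚ] (1 : CyclotomicField m ℚ)) * ((x : ℚ_[p]) ⊗ₜ[ℚ] (1 : CyclotomicField m ℚ)) * (Θ * Θ * l₀) =
        (Θ * ((x : ℚ_[p]) ⊗ₜ[ℚ] (1 : CyclotomicField m ℚ))) * (Θ * ((x : ℚ_[p]) ⊗ₜ[ℚ] (1 : CyclotomicField m ℚ))) * l₀ := by ring
    rw [h1, h2, hΘx, PadicInt.coe_mul]
    have h3 : (((P : ℚ_[p]) * (P : ℚ_[p])) ⊗ₜ[ℚ] (1 : CyclotomicField m ℚ)) =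
        ((P : ℚ_[p]) ⊗ₜ[ℚ] (1 : CyclotomicField m ℚ)) * ((P : ℚ_[p]) ⊗ₜ[ℚ] (1 : CyclotomicField m ℚ)) := by
      rw [Algebra.TensorProduct.tmul_mul_tmul, mul_one]
    rw [h3]; ring
  have hLmem : ν * ν * l₀ ∈ cycIntLattice p m :=
    KimAtThreePortSharedSATCore.mul_mem_cycIntLattice p m
      (KimAtThreePortSharedSATCore.mul_mem_cycIntLattice p m hνmem hνmem) hl₀
  -- apply the coordinate functional: `‖p·x²‖ ≤ ‖P²‖`
  obtain ⟨τ, hτ1, hτ⟩ := exists_coordFunctional p m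
  have hτc : ∀ c : ℚ_[p], τ (c ⊗ₜ[ℚ] (1 : CyclotomicField m ℚ)) = c := by
    intro c
    have : (c ⊗ₜ[ℚ] (1 : CyclotomicField m ℚ)) = c • ((1 : ℚ_[p]) ⊗ₜ[ℚ] (1 : CyclotomicField m ℚ)) := by
      rw [TensorProduct.smul_tmul', smul_eq_mul, mul_one]
    rw [this, map_smul, hτ1, smul_eq_mul, mul_one]
  have hnorm : ‖(p : ℤ_[p]) * (x * x)‖ ≤ ‖P * P‖ := by
    have h1 : τ (((p : ℚ_[p]) * ((x : ℚ_[p]) * (x : ℚ_[p]))) ⊗ₜ[ℚ] (1 : CyclotomicField m ℚ)) =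
        ((P * P : ℤ_[p]) : ℚ_[p]) * τ (ν * ν * l₀) := by
      rw [hsq, KimAtThreePortSharedSATCore.coe_tmul_one_eq_algebraMap, ← Algebra.smul_def, map_smul,
        smul_eq_mul]
    rw [hτc] at h1
    have h2 : ‖((p : ℤ_[p]) * (x * x) : ℤ_[p])‖ = ‖(p : ℚ_[p]) * ((x : ℚ_[p]) * (x : ℚ_[p]))‖ := by
      rw [PadicInt.norm_def, PadicInt.coe_mul, PadicInt.coe_mul, PadicInt.coe_natCast]
    rw [h2, h1, norm_mul, PadicInt.norm_def]
    exact mul_le_of_le_one_right (norm_nonneg _) (hτ _ hLmem)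
  -- valuation parity: `1 + 2 v(x) ≥ 2k + 2 ⇒ v(x) ≥ k + 1`
  have hxmem : x ∈ (Ideal.span {(p : ℤ_[p]) ^ (k + 1)} : Ideal ℤ_[p]) := by
    by_cases hx0 : x = 0
    · rw [hx0]; exact Submodule.zero_mem _
    have hp0 : (p : ℤ_[p]) ≠ 0 := by exact_mod_cast (Fact.out : p.Prime).ne_zero
    have hy0 : (p : ℤ_[p]) * (x * x) ≠ 0 := mul_ne_zero hp0 (mul_ne_zero hx0 hx0)
    have hPP : ‖P * P‖ = (p : ℝ) ^ (-((2 * (k + 1) : ℕ) : ℤ)) := by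
      rw [hP, ← pow_add, PadicInt.norm_p_pow]; congr 2; push_cast; ring
    rw [hPP, PadicInt.norm_le_pow_iff_le_valuation _ hy0] at hnorm
    rw [PadicInt.valuation_mul hp0 (mul_ne_zero hx0 hx0), PadicInt.valuation_mul hx0 hx0,
      PadicInt.valuation_p] at hnorm
    rw [PadicInt.mem_span_pow_iff_le_valuation x hx0]
    omega
  have hx0 : PadicInt.toZModPow (k + 1) x = 0 := by
    rw [← RingHom.mem_ker, PadicInt.ker_toZModPow]; exact hxmem
  rwa [hx, map_sub, sub_eq_zero] at hx0

set_option backward.isDefEq.respectTransparency false in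
/-- **`θ = 1` is a weight**: `1 ⊗ 1 ∈ L_int` and `(1 ⊗ 1)²·(p ⊗ 1) = p ⊗ 1` with `p ⊗ 1 ∈ L_int`. [folklore] -/
theorem weight_one :
    ((1 : ℚ_[p]) ⊗ₜ[ℚ] (1 : CyclotomicField m ℚ)) ∈ cycIntLattice p m ∧
    ∃ l₀ ∈ cycIntLattice p m,
      ((1 : ℚ_[p]) ⊗ₜ[ℚ] (1 : CyclotomicField m ℚ)) * ((1 : ℚ_[p]) ⊗ₜ[ℚ] (1 : CyclotomicField m ℚ)) * l₀ =
        ((p : ℚ_[p]) ⊗ₜ[ℚ] (1 : CyclotomicField m ℚ)) := by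
  refine ⟨one_tmul_one_mem_cycIntLattice p m, (p : ℚ_[p]) ⊗ₜ[ℚ] (1 : CyclotomicField m ℚ), ?_, ?_⟩
  · have h := GroupRingEval.coe_tmul_one_mem_cycIntLattice p m (p : ℤ_[p])
    rwa [PadicInt.coe_natCast] at h
  · rw [Algebra.TensorProduct.tmul_mul_tmul, Algebra.TensorProduct.tmul_mul_tmul, one_mul, one_mul, one_mul,
      one_mul]

set_option backward.isDefEq.respectTransparency false in
/-- **`θ = 1 − ζ₃` is a weight at `p = 3` on a WILD level `3 ∣ m`**: with `ζ₃ := ζ_m^{m/3}` (a primitive cube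
root of unity), `1 ⊗ (1 − ζ₃) ∈ L_int(m)` and `(1 ⊗ (1 − ζ₃))²·(1 ⊗ (−ζ₃²)) = 3 ⊗ 1` — since
`(1 − ζ₃)² = −3ζ₃` (`1 + ζ₃ + ζ₃² = 0`).  This is the uniformiser of the tamely ramified completions
`ℚ(ζ_m)_w`, `w ∣ 3`, whose inverse different is `(1 − ζ₃)⁻¹𝒪_w`. [folklore] -/
theorem weight_one_sub_zeta_pow (hm : 3 ∣ m) :
    ((1 : ℚ_[3]) ⊗ₜ[ℚ] (1 - IsCyclotomicExtension.zeta m ℚ (CyclotomicField m ℚ) ^ (m / 3))) ∈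
        cycIntLattice 3 m ∧
    ∃ l₀ ∈ cycIntLattice 3 m,
      ((1 : ℚ_[3]) ⊗ₜ[ℚ] (1 - IsCyclotomicExtension.zeta m ℚ (CyclotomicField m ℚ) ^ (m / 3))) *
          ((1 : ℚ_[3]) ⊗ₜ[ℚ] (1 - IsCyclotomicExtension.zeta m ℚ (CyclotomicField m ℚ) ^ (m / 3))) * l₀ =
        (((3 : ℕ) : ℚ_[3]) ⊗ₜ[ℚ] (1 : CyclotomicField m ℚ)) := by
  have hζ : IsPrimitiveRoot (IsCyclotomicExtension.zeta m ℚ (CyclotomicField m ℚ)) m :=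
    IsCyclotomicExtension.zeta_spec m ℚ (CyclotomicField m ℚ)
  have hω3 : IsPrimitiveRoot (IsCyclotomicExtension.zeta m ℚ (CyclotomicField m ℚ) ^ (m / 3)) 3 :=
    hζ.pow (NeZero.pos m) (Nat.div_mul_cancel hm).symm
  -- `(1 − ω)²·(−ω²) = 3` for a primitive cube root of unity `ω`
  have key : ∀ ω : CyclotomicField m ℚ, IsPrimitiveRoot ω 3 → (1 - ω) * (1 - ω) * (-(ω ^ 2)) = 3 := by
    intro ω hω
    have h3 : ω ^ 3 = 1 := hω.pow_eq_one
    have hs : 1 + ω + ω ^ 2 = 0 := by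
      have := hω.geom_sum_eq_zero (by norm_num : 1 < 3)
      simpa [Finset.sum_range_succ, add_assoc] using this
    linear_combination (2 - ω) * h3 + (-1 : CyclotomicField m ℚ) * hs
  have hid := key _ hω3
  -- `1 ⊗ ζ^j ∈ L_int` (the generators are the powers `(1 ⊗ ζ)^j = 1 ⊗ ζ^j`)
  have hz : ∀ j : ℕ, ((1 : ℚ_[3]) ⊗ₜ[ℚ] (IsCyclotomicExtension.zeta m ℚ (CyclotomicField m ℚ) ^ j)) ∈
      cycIntLattice 3 m := by
    intro j
    have h := one_tmul_zeta_pow_mem_cycIntLattice 3 m j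
    rwa [Algebra.TensorProduct.tmul_pow, one_pow] at h
  refine ⟨?_, (1 : ℚ_[3]) ⊗ₜ[ℚ] (-((IsCyclotomicExtension.zeta m ℚ (CyclotomicField m ℚ) ^ (m / 3)) ^ 2)),
    ?_, ?_⟩
  · rw [TensorProduct.tmul_sub]
    exact (cycIntLattice 3 m).sub_mem (one_tmul_one_mem_cycIntLattice 3 m) (hz (m / 3))
  · rw [TensorProduct.tmul_neg, ← pow_mul]
    exact (cycIntLattice 3 m).neg_mem (hz (m / 3 * 2))
  · rw [Algebra.TensorProduct.tmul_mul_tmul, Algebra.TensorProduct.tmul_mul_tmul, one_mul, one_mul, hid]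
    have h3K : (3 : CyclotomicField m ℚ) = (3 : ℚ) • (1 : CyclotomicField m ℚ) := by
      rw [Algebra.smul_def, mul_one, map_ofNat]
    rw [h3K, TensorProduct.tmul_smul, TensorProduct.smul_tmul', Algebra.smul_def, mul_one, map_ofNat,
      Nat.cast_ofNat]

end Weighted

/-! ### §2 The two-exponent rider of the scaled datum from the interface + the WEIGHTED compatibility -/

section Rider

variable (W : WeierstrassCurve ℚ) [W.IsElliptic] [ContinuousSMul ℤ_[3] (W.tateModule 3)]
  (v₃ : HeightOneSpectrum (𝓞 ℚ))
  (Λ : ∀ (k' : ℕ) (r : Finset (HeightOneSpectrum (𝓞 ℚ))),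
    H1 (tateRep W 3) (cycSubgroup 3 k' r) →ₗ[ℤ_[3]] ℚ_[3] ⊗[ℚ] CyclotomicField (cycLevel 3 k' r) ℚ)
  (φ φ' : (tateLocalRep W 3 (Sum.inr v₃)).cohomology 1 →+ ℚ_[3])
  (θ : ∀ r : Finset (HeightOneSpectrum (𝓞 ℚ)), CyclotomicField (cycLevel 3 0 r) ℚ)

set_option backward.isDefEq.respectTransparency false in
/-- **X1-int_b ⟹ COMPATW_b with the trivial weights `θ_r := 1`** (multiply by `1 ⊗ 1 = 1`). [folklore] -/
theorem compatW_of_compat (j b : ℕ) (hcompat : COMPAT⟦W, j, v₃, Λ, φ, b⟧) :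
    COMPATW⟦W, j, v₃, Λ, φ, b, (fun r => (1 : CyclotomicField (cycLevel 3 0 r) ℚ))⟧ := by
  intro r Ψ hΨ y κ₀ h hres hloc
  obtain ⟨l, hl, hc⟩ := hcompat r Ψ hΨ y κ₀ h hres hloc
  refine ⟨l, hl, ?_⟩
  rw [← hc]
  exact one_mul _

set_option backward.isDefEq.respectTransparency false in
/-- **`RIDER₂⟦W, j, t, e, v₃, 3^a·Λ, Λfin_j⟧` DERIVED from the WEIGHTED compatibility** — seat w2-c3's
`rider₂_of_compat` with the scalar step replaced by §1: from the interface of a NORMALISED `φ′`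
(`φ′(y) = s ⇒ Λfin_j(π_{j+1,*} y) = s mod 3^{j+1}`), the scaling `φ = 3^{λ₀}·φ′`, admissible weights `θ`
and COMPATW_b at depth `j` (DISPLAYED: `∃ l ∈ L_int, (1 ⊗ θ_r)·3^b·(φ(h) ⊗ 1 − Λ_{0,r}(y)) = 3^{j+1}·l` — for
Kato's witnesses `θ_r·3·exp*_ω(H¹(K_𝔓,T)) ⊆ 𝒪_{K_𝔓}` at every place `𝔓 ∣ 3`, `θ_r = 1` resp. `1 − ζ₃`,
i.e. `b = 1`), whenever `b ≤ a` and `e = t + a + λ₀`.  The SAME exponents as the unweighted rider: no digit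
is lost to the weight. [cite: Kim2022StructureSelmer, §3.3–§3.4.1 and the proof of Thm. 3.13 (arXiv v3 pp. 26–27)]
[cite: KimNakamura2020, Thm. 2.1 and Cor. 2.4] [cite: BlochKato1990, §3 (Prop. 3.8, Ex. 3.11)] -/
theorem rider₂_of_weightedCompat (lam : ℤ) (hφ : ∀ y, φ y = (3 : ℚ_[3]) ^ lam * φ' y)
    (hint' : ∀ y, ‖φ' y‖ ≤ 1) (j : ℕ)
    (Λfin : galoisCohomology ((W.torsionGaloisModule (((3 : ℕ) : ℤ) ^ j * ((3 : ℕ) : ℤ))).toLocal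
      (Sum.inr v₃)) 1 →+ ZMod (3 ^ (j + 1)))
    (hI : ∀ (y : (tateLocalRep W 3 (Sum.inr v₃)).cohomology 1) (s : ℤ_[3]), φ' y = s →
      Λfin (tateLocalMap W 3 j (Sum.inr v₃) y) = PadicInt.toZModPow (j + 1) s)
    (hθ : WEIGHT⟦θ⟧) (b : ℕ) (hcompat : COMPATW⟦W, j, v₃, Λ, φ, b, θ⟧)
    (a t e : ℕ) (hab : b ≤ a) (he : (e : ℤ) = (t : ℤ) + a + lam) :
    RIDER₂⟦W, j, t, e, v₃, (fun k' r => (((3 : ℕ) : ℤ_[3]) ^ a) • Λ k' r), Λfin⟧ := by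
  intro r Ψ hΨ y κ₀ s hres hloc hprem
  obtain ⟨h, hh⟩ := (mem_propagatedSelmerStructure_iff W 3 j (Sum.inr v₃) _).mp hloc
  obtain ⟨l₂, hl₂, hc⟩ := hcompat r Ψ hΨ y κ₀ h hres hh.symm
  set Θ : ℚ_[3] ⊗[ℚ] CyclotomicField (cycLevel 3 0 r) ℚ := (1 : ℚ_[3]) ⊗ₜ[ℚ] θ r with hΘ
  -- the integer `E := 3^e · φ′(h) = 3^{t+a} · φ(h)`
  set sh : ℤ_[3] := ⟨φ' h, hint' h⟩ with hsh
  have hφ'h : φ' h = (sh : ℚ_[3]) := rfl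
  set E : ℤ_[3] := ((3 : ℕ) : ℤ_[3]) ^ e * sh with hE
  have hEq : (E : ℚ_[3]) = ((3 : ℕ) : ℚ_[3]) ^ (t + a) * φ h := by
    rw [hE, PadicInt.coe_mul, PadicInt.coe_pow, PadicInt.coe_natCast, ← hφ'h, hφ h, ← mul_assoc]
    congr 1
    rw [← zpow_natCast, ← zpow_natCast, Nat.cast_ofNat, ← zpow_add₀ (by norm_num : (3 : ℚ_[3]) ≠ 0), he]
    push_cast
    ring_nf
  -- the value side: `Λfin (loc κ₀) = φ′(h) mod 3^{j+1}`
  rw [← hh, hI h sh hφ'h]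
  have hlhs : ((3 ^ e : ℕ) : ZMod (3 ^ (j + 1))) * PadicInt.toZModPow (j + 1) sh =
      PadicInt.toZModPow (j + 1) E := by
    rw [hE, map_mul, map_pow, map_natCast, Nat.cast_pow]
  rw [hlhs]
  -- §1 with `v := 3^t · (3^a Λ)_{0,r}(y)` and the weight `θ_r`
  refine toZModPow_eq_of_weighted_sub_eq_smul_cycIntLattice 3 (cycLevel 3 0 r) (hθ r).1 (hθ r).2 ?_ hprem
  -- `Θ·(E ⊗ 1 − 3^t • 3^a • Λ y) = Θ · 3^{t+a-b} • 3^b • (φ h ⊗ 1 − Λ y) = 3^{j+1} • (3^{t+a-b} • l₂)`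
  set c : ℕ := t + a - b with hcdef
  have htab : t + a = c + b := by omega
  have hv : (((3 : ℕ) : ℤ_[3]) ^ t) • ((((3 : ℕ) : ℤ_[3]) ^ a) • Λ 0 r) y =
      (((3 : ℕ) : ℤ_[3]) ^ (t + a)) • Λ 0 r y := by
    rw [LinearMap.smul_apply, smul_smul, ← pow_add]
  have hE1 : ((E : ℚ_[3]) ⊗ₜ[ℚ] (1 : CyclotomicField (cycLevel 3 0 r) ℚ)) =
      (((3 : ℕ) : ℤ_[3]) ^ (t + a)) • (φ h ⊗ₜ[ℚ] (1 : CyclotomicField (cycLevel 3 0 r) ℚ)) := by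
    rw [hEq, KimAtThreePortSharedSATCore.padicInt_smul_eq_coe_smul, PadicInt.coe_pow, PadicInt.coe_natCast,
      TensorProduct.smul_tmul', smul_eq_mul]
  refine ⟨(((3 : ℕ) : ℤ_[3]) ^ c) • l₂, (cycIntLattice 3 (cycLevel 3 0 r)).smul_mem _ hl₂, ?_⟩
  change Θ * (((E : ℚ_[3]) ⊗ₜ[ℚ] (1 : CyclotomicField (cycLevel 3 0 r) ℚ)) -
      (((3 : ℕ) : ℤ_[3]) ^ t) • ((((3 : ℕ) : ℤ_[3]) ^ a) • Λ 0 r) y) = _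
  rw [hv, hE1, ← smul_sub, htab, pow_add, mul_smul, mul_smul_comm, hc, smul_smul, smul_smul, mul_comm]

end Rider

end Summit.BirchSwinnertonDyer.BirchSwinnertonDyer.Theorems.KimAtThreeShallowEqDeepRiderOfWeightedCompat

end
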